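import Summits.HubbardSuperconductivity.HubbardSuperconductivity.Theorems.AnisotropyChordXXZHoppingFormula
import Summits.HubbardSuperconductivity.HubbardSuperconductivity.Theorems.AnisotropyChordInsertionEntropyUniformDensity

/-!
# Route `AnisotropyChord` / H0 rotor rung: the GROUND-STATE TRANSFORM of the spin-½ XXZ quadratic form
# (toolkit for the diamagnetic grid bound (S5)(c), theory seat memo ROTOR-THEORY-8 §109)

For `H = xxzHamiltonian 1 G (−1) Δ` on any finite graph, a real vector `ψ` with `Hψ = E₀ψ` and any `φ = u·ψ`
(pointwise product with a complex function `u`):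

  `Re⟨φ, Hφ⟩ − E₀ ‖φ‖² = Σ_{{x,y} ∈ E} ¼ Σ_{σ : σ_x ≠ σ_y} ψ(σ) ψ(σ∘swap_{xy}) |u(σ) − u(σ∘swap_{xy})|²`

(`xxz_groundStateTransform`): the diagonal (Ising and `E₀`) terms are traded for the hopping terms through the
eigen-equation, and the hopping sum is symmetrised along the involution `σ ↦ σ∘swap_{xy}` of the flippable
configurations of each bond.  Doob / Allegretto–Piepenbrink ground-state transform; no positivity of `ψ` is
needed for the identity itself.
-/

set_option linter.dupNamespace false

noncomputable section

open Matrix Complex Finset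
open scoped ComplexConjugate
open Literature.MathematicalPhysics.QuantumLattice
open Summit.HubbardSuperconductivity.HubbardSuperconductivity.Theorems.AnisotropyChord.OneMagnon
  (xxz_mulVec_apply)
open Summit.HubbardSuperconductivity.HubbardSuperconductivity.Theorems.AnisotropyChord.InsertionEntropy
  (sum_config_comp_equiv)

namespace Summit.HubbardSuperconductivity.HubbardSuperconductivity.Theorems.AnisotropyChord.Stiffness

variable {V : Type} [Fintype V] [DecidableEq V]

/-! ## The involution of the flippable configurations of a bond -/

omit [Fintype V] in
/-- `(σ ∘ swap) ∘ swap = σ`. [folklore] -/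
theorem comp_swap_comp_swap (σ : V → Fin 2) (x y : V) :
    (σ ∘ Equiv.swap x y) ∘ Equiv.swap x y = σ := by
  funext z; simp [Equiv.swap_apply_self]

omit [Fintype V] in
/-- Flippability is invariant under the swap: `(σ∘swap)_x ≠ (σ∘swap)_y ↔ σ_x ≠ σ_y`. [folklore] -/
theorem comp_swap_ne_iff (σ : V → Fin 2) (x y : V) :
    (σ ∘ Equiv.swap x y) x ≠ (σ ∘ Equiv.swap x y) y ↔ σ x ≠ σ y := by
  simp only [Function.comp_apply, Equiv.swap_apply_left, Equiv.swap_apply_right]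
  exact ne_comm

/-- **Reindexing along the bond involution:** `Σ_σ F(σ∘swap, σ) = Σ_σ F(σ, σ∘swap)`. [folklore] -/
theorem sum_comp_swap_symm {β : Type*} [AddCommMonoid β] (x y : V) (F : (V → Fin 2) → (V → Fin 2) → β) :
    ∑ σ : V → Fin 2, F (σ ∘ Equiv.swap x y) σ = ∑ σ : V → Fin 2, F σ (σ ∘ Equiv.swap x y) := by
  have h := sum_config_comp_equiv (Equiv.swap x y) (fun τ => F τ (τ ∘ Equiv.swap x y))
  simp only [comp_swap_comp_swap] at h
  exact h

/-- **Symmetrisation of the flippable sum:** for a weight `w` symmetric under the swap,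
`Σ_{σ flippable} w(σ) g(σ) = Σ_{σ flippable} w(σ) g(σ∘swap)`. [folklore] -/
theorem sum_flip_symm {β : Type*} [AddCommMonoid β] (x y : V) (w : (V → Fin 2) → β → β)
    (g : (V → Fin 2) → β) (f : (V → Fin 2) → β)
    (hf : ∀ σ, f σ = if σ x ≠ σ y then w σ (g σ) else 0)
    (hw : ∀ σ b, w (σ ∘ Equiv.swap x y) b = w σ b) :
    ∑ σ : V → Fin 2, f σ = ∑ σ : V → Fin 2, (if σ x ≠ σ y then w σ (g (σ ∘ Equiv.swap x y)) else 0) := by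
  simp_rw [hf]
  rw [← sum_comp_swap_symm x y (fun a b => if a x ≠ a y then w a (g b) else 0)]
  refine Finset.sum_congr rfl fun σ _ => ?_
  simp only [comp_swap_ne_iff, hw]

/-! ## The eigen-equation and the ground-state transform -/

/-- The XXZ eigen-equation on a configuration, for a real eigenvector (from `xxz_mulVec_apply`):
`(−ΔZ(σ) − E₀) ψ(σ) = ½ Σ_{e} [σ flippable at e] ψ(σ∘swap_e)`. [folklore] -/
theorem xxz_eigen_config (G : SimpleGraph V) [DecidableRel G.Adj] (Δ : ℝ) (ψ : (V → Fin 2) → ℝ) (E₀ : ℝ)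
    (hψ : (xxzHamiltonian 1 G (-1) Δ : Op V 2) *ᵥ (fun σ => (ψ σ : ℂ)) = (E₀ : ℂ) • fun σ => (ψ σ : ℂ))
    (σ : V → Fin 2) :
    (-((Δ * ∑ e ∈ G.edgeFinset, Sym2.lift ⟨fun x y => ((1 : ℝ) / 2 - (σ x : ℕ)) * ((1 : ℝ) / 2 - (σ y : ℕ)),
          fun _ _ => mul_comm _ _⟩ e : ℝ) : ℂ) - (E₀ : ℂ)) * (ψ σ : ℂ)
      = (1 / 2 : ℂ) * ∑ e ∈ G.edgeFinset,
          Sym2.lift ⟨fun x y => if σ x ≠ σ y then (ψ (σ ∘ Equiv.swap x y) : ℂ) else 0, fun x y => by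
            simp only [ne_comm, Equiv.swap_comm]⟩ e := by
  have h := congrFun hψ σ
  rw [xxz_mulVec_apply, Pi.smul_apply, smul_eq_mul] at h
  linear_combination h

/-- **THE GROUND-STATE TRANSFORM of the XXZ form.**  For `Hψ = E₀ψ` (`ψ` real) and `φ = u·ψ`:
`Re⟨φ, Hφ⟩ − E₀ Σ_σ |φ(σ)|² = Σ_{{x,y}∈E} ¼ Σ_{σ : σ_x ≠ σ_y} ψ(σ)ψ(σ∘swap) |u(σ) − u(σ∘swap)|²`. [folklore] -/
theorem xxz_groundStateTransform (G : SimpleGraph V) [DecidableRel G.Adj] (Δ : ℝ) (ψ : (V → Fin 2) → ℝ)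
    (E₀ : ℝ)
    (hψ : (xxzHamiltonian 1 G (-1) Δ : Op V 2) *ᵥ (fun σ => (ψ σ : ℂ)) = (E₀ : ℂ) • fun σ => (ψ σ : ℂ))
    (u φ : (V → Fin 2) → ℂ) (hφ : ∀ σ, φ σ = u σ * (ψ σ : ℂ)) :
    (star φ ⬝ᵥ ((xxzHamiltonian 1 G (-1) Δ : Op V 2) *ᵥ φ)).re - E₀ * ∑ σ, ‖φ σ‖ ^ 2
      = ∑ e ∈ G.edgeFinset, Sym2.lift ⟨fun x y => (1 / 4 : ℝ) *
          ∑ σ : V → Fin 2, (if σ x ≠ σ y then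
            ψ σ * ψ (σ ∘ Equiv.swap x y) * ‖u σ - u (σ ∘ Equiv.swap x y)‖ ^ 2 else 0),
          fun x y => by simp only [ne_comm, Equiv.swap_comm]⟩ e := by
  classical
  set H : Op V 2 := xxzHamiltonian 1 G (-1) Δ with hH
  -- Step 1: the complex identity `⟨φ,Hφ⟩ − E₀‖φ‖² = ½ Σ_e Σ_σ [flip] ψψ' (|u|² − conj u u')`
  have hnorm : ∀ σ, ((‖φ σ‖ ^ 2 : ℝ) : ℂ) = conj (φ σ) * φ σ := by
    intro σ; rw [← Complex.normSq_eq_norm_sq, Complex.normSq_eq_conj_mul_self]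
  have step1 : star φ ⬝ᵥ (H *ᵥ φ) - (E₀ : ℂ) * ∑ σ, ((‖φ σ‖ ^ 2 : ℝ) : ℂ)
      = (1 / 2 : ℂ) * ∑ e ∈ G.edgeFinset, Sym2.lift ⟨fun x y =>
          ∑ σ : V → Fin 2, (if σ x ≠ σ y then
            (ψ σ : ℂ) * (ψ (σ ∘ Equiv.swap x y) : ℂ) *
              (conj (u σ) * u σ - conj (u σ) * u (σ ∘ Equiv.swap x y)) else 0),
          fun x y => by simp only [ne_comm, Equiv.swap_comm]⟩ e := by
    -- expand `⟨φ, Hφ⟩` configuration by configuration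
    have hexp : star φ ⬝ᵥ (H *ᵥ φ) - (E₀ : ℂ) * ∑ σ, ((‖φ σ‖ ^ 2 : ℝ) : ℂ)
        = ∑ σ, (conj (φ σ) * (H *ᵥ φ) σ - (E₀ : ℂ) * (conj (φ σ) * φ σ)) := by
      rw [dotProduct, Finset.mul_sum, ← Finset.sum_sub_distrib]
      refine Finset.sum_congr rfl fun σ _ => ?_
      rw [Pi.star_apply, hnorm]; rfl
    rw [hexp]
    -- per configuration: use the hopping formula and the eigen-equation
    have hσ : ∀ σ, conj (φ σ) * (H *ᵥ φ) σ - (E₀ : ℂ) * (conj (φ σ) * φ σ)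
        = (1 / 2 : ℂ) * ∑ e ∈ G.edgeFinset, Sym2.lift ⟨fun x y =>
            (if σ x ≠ σ y then
              (ψ σ : ℂ) * (ψ (σ ∘ Equiv.swap x y) : ℂ) *
                (conj (u σ) * u σ - conj (u σ) * u (σ ∘ Equiv.swap x y)) else 0),
            fun x y => by simp only [ne_comm, Equiv.swap_comm]⟩ e := by
      intro σ
      rw [hH, xxz_mulVec_apply]
      have heig := xxz_eigen_config G Δ ψ E₀ hψ σ
      -- `conj φ (−ΔZ φ) − E₀ |φ|² = |u|² ψ · (−ΔZ − E₀) ψ = |u|² ψ · ½ Σ_e [flip] ψ'`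
      have hdiag : conj (φ σ) * (-((Δ * ∑ e ∈ G.edgeFinset, Sym2.lift ⟨fun x y =>
            ((1 : ℝ) / 2 - (σ x : ℕ)) * ((1 : ℝ) / 2 - (σ y : ℕ)), fun _ _ => mul_comm _ _⟩ e : ℝ) : ℂ)
              * φ σ) - (E₀ : ℂ) * (conj (φ σ) * φ σ)
          = conj (u σ) * u σ * (ψ σ : ℂ) * ((1 / 2 : ℂ) * ∑ e ∈ G.edgeFinset,
              Sym2.lift ⟨fun x y => if σ x ≠ σ y then (ψ (σ ∘ Equiv.swap x y) : ℂ) else 0, fun x y => by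
                simp only [ne_comm, Equiv.swap_comm]⟩ e) := by
        rw [← heig, hφ σ, map_mul, Complex.conj_ofReal]; ring
      -- reorganise: the hopping part applied to `φ = uψ`
      have hhop : conj (φ σ) * ((1 / 2 : ℂ) * ∑ e ∈ G.edgeFinset, Sym2.lift ⟨fun x y =>
            if σ x ≠ σ y then φ (σ ∘ Equiv.swap x y) else 0, fun x y => by
              simp only [ne_comm, Equiv.swap_comm]⟩ e)
          = (1 / 2 : ℂ) * ∑ e ∈ G.edgeFinset, Sym2.lift ⟨fun x y =>
              (if σ x ≠ σ y then (ψ σ : ℂ) * (ψ (σ ∘ Equiv.swap x y) : ℂ) *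
                (conj (u σ) * u (σ ∘ Equiv.swap x y)) else 0),
              fun x y => by simp only [ne_comm, Equiv.swap_comm]⟩ e := by
        rw [← mul_assoc, mul_comm (conj (φ σ)), mul_assoc, Finset.mul_sum]
        congr 1
        refine Finset.sum_congr rfl fun e _ => ?_
        induction e using Sym2.ind with
        | h x y =>
          simp only [Sym2.lift_mk]
          split_ifs with hne
          · rw [hφ σ, hφ (σ ∘ Equiv.swap x y), map_mul, Complex.conj_ofReal]; ring
          · rw [mul_zero]
      have hdiag' : conj (φ σ) * (-((Δ * ∑ e ∈ G.edgeFinset, Sym2.lift ⟨fun x y =>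
            ((1 : ℝ) / 2 - (σ x : ℕ)) * ((1 : ℝ) / 2 - (σ y : ℕ)), fun _ _ => mul_comm _ _⟩ e : ℝ) : ℂ)
              * φ σ)
          = (E₀ : ℂ) * (conj (φ σ) * φ σ) + (1 / 2 : ℂ) * ∑ e ∈ G.edgeFinset,
              Sym2.lift ⟨fun x y => (if σ x ≠ σ y then (ψ σ : ℂ) * (ψ (σ ∘ Equiv.swap x y) : ℂ) *
                (conj (u σ) * u σ) else 0), fun x y => by simp only [ne_comm, Equiv.swap_comm]⟩ e := by
        have h2 : conj (u σ) * u σ * (ψ σ : ℂ) * ((1 / 2 : ℂ) * ∑ e ∈ G.edgeFinset,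
              Sym2.lift ⟨fun x y => if σ x ≠ σ y then (ψ (σ ∘ Equiv.swap x y) : ℂ) else 0, fun x y => by
                simp only [ne_comm, Equiv.swap_comm]⟩ e)
            = (1 / 2 : ℂ) * ∑ e ∈ G.edgeFinset,
              Sym2.lift ⟨fun x y => (if σ x ≠ σ y then (ψ σ : ℂ) * (ψ (σ ∘ Equiv.swap x y) : ℂ) *
                (conj (u σ) * u σ) else 0), fun x y => by simp only [ne_comm, Equiv.swap_comm]⟩ e := by
          rw [← mul_assoc, mul_comm (conj (u σ) * u σ * (ψ σ : ℂ)), mul_assoc, Finset.mul_sum]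
          congr 1
          refine Finset.sum_congr rfl fun e _ => ?_
          induction e using Sym2.ind with
          | h x y =>
            simp only [Sym2.lift_mk]
            split_ifs with hne
            · ring
            · rw [mul_zero]
        linear_combination hdiag + h2
      rw [mul_sub, hdiag', hhop, Finset.mul_sum, Finset.mul_sum, Finset.mul_sum]
      rw [show ∀ a b c d : ℂ, a + b - c - d = (b - c) + (a - d) from fun a b c d => by ring, sub_self, add_zero,
        ← Finset.sum_sub_distrib]
      refine Finset.sum_congr rfl fun e _ => ?_
      induction e using Sym2.ind with
      | h x y =>
        simp only [Sym2.lift_mk]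
        split_ifs with hne
        · ring
        · ring
    rw [Finset.sum_congr rfl fun σ _ => hσ σ, ← Finset.mul_sum, Finset.sum_comm]
    congr 1
    refine Finset.sum_congr rfl fun e _ => ?_
    induction e using Sym2.ind with
    | h x y => simp only [Sym2.lift_mk]
  -- Step 2: real parts and symmetrisation along the bond involution
  have hre : (star φ ⬝ᵥ (H *ᵥ φ)).re - E₀ * ∑ σ, ‖φ σ‖ ^ 2
      = (star φ ⬝ᵥ (H *ᵥ φ) - (E₀ : ℂ) * ∑ σ, ((‖φ σ‖ ^ 2 : ℝ) : ℂ)).re := by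
    rw [Complex.sub_re, ← Complex.ofReal_sum, ← Complex.ofReal_mul, Complex.ofReal_re]
  rw [hre, step1, show (1 / 2 : ℂ) = ((1 / 2 : ℝ) : ℂ) by norm_num, Complex.re_ofReal_mul, Complex.re_sum,
    Finset.mul_sum]
  refine Finset.sum_congr rfl fun e _ => ?_
  induction e using Sym2.ind with
  | h x y =>
    simp only [Sym2.lift_mk]
    rw [Complex.re_sum]
    -- symmetrise the `|u σ|²` term
    have hsym : ∑ σ : V → Fin 2, (if σ x ≠ σ y then
          ψ σ * ψ (σ ∘ Equiv.swap x y) * ‖u σ‖ ^ 2 else 0)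
        = ∑ σ : V → Fin 2, (if σ x ≠ σ y then
          ψ σ * ψ (σ ∘ Equiv.swap x y) * ‖u (σ ∘ Equiv.swap x y)‖ ^ 2 else 0) :=
      sum_flip_symm x y (fun σ b => ψ σ * ψ (σ ∘ Equiv.swap x y) * b) (fun σ => ‖u σ‖ ^ 2) _
        (fun σ => rfl) (fun σ b => by rw [comp_swap_comp_swap]; ring)
    -- termwise real parts
    have hterm : ∀ σ : V → Fin 2, (if σ x ≠ σ y then
          (ψ σ : ℂ) * (ψ (σ ∘ Equiv.swap x y) : ℂ) *
            (conj (u σ) * u σ - conj (u σ) * u (σ ∘ Equiv.swap x y)) else 0).re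
        = (if σ x ≠ σ y then ψ σ * ψ (σ ∘ Equiv.swap x y) * ‖u σ‖ ^ 2 else 0)
          - (if σ x ≠ σ y then ψ σ * ψ (σ ∘ Equiv.swap x y) *
              (conj (u σ) * u (σ ∘ Equiv.swap x y)).re else 0) := by
      intro σ
      split_ifs with hne
      · have e1 : (ψ σ : ℂ) * (ψ (σ ∘ Equiv.swap x y) : ℂ) *
            (conj (u σ) * u σ - conj (u σ) * u (σ ∘ Equiv.swap x y))
            = ((ψ σ * ψ (σ ∘ Equiv.swap x y) : ℝ) : ℂ) *
              (((‖u σ‖ ^ 2 : ℝ) : ℂ) - conj (u σ) * u (σ ∘ Equiv.swap x y)) := by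
          rw [← Complex.normSq_eq_norm_sq, Complex.normSq_eq_conj_mul_self]; push_cast; ring
        rw [e1, Complex.re_ofReal_mul, Complex.sub_re, Complex.ofReal_re]; ring
      · simp
    simp_rw [hterm]
    rw [Finset.sum_sub_distrib]
    -- the identity `|u|² (symmetrised) − Re(conj u u') = ½ |u − u'|²`
    have hsq : ∀ σ : V → Fin 2,
        ‖u σ - u (σ ∘ Equiv.swap x y)‖ ^ 2
          = ‖u σ‖ ^ 2 + ‖u (σ ∘ Equiv.swap x y)‖ ^ 2
            - 2 * (conj (u σ) * u (σ ∘ Equiv.swap x y)).re := by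
      intro σ
      rw [← Complex.normSq_eq_norm_sq, ← Complex.normSq_eq_norm_sq, ← Complex.normSq_eq_norm_sq,
        Complex.normSq_sub]
      simp only [Complex.mul_re, Complex.conj_re, Complex.conj_im, Complex.normSq_apply]
      ring
    have hhalf : ∑ σ : V → Fin 2, (if σ x ≠ σ y then ψ σ * ψ (σ ∘ Equiv.swap x y) * ‖u σ‖ ^ 2 else 0)
        = (1 / 2 : ℝ) * ∑ σ : V → Fin 2, (if σ x ≠ σ y then ψ σ * ψ (σ ∘ Equiv.swap x y) *
            (‖u σ‖ ^ 2 + ‖u (σ ∘ Equiv.swap x y)‖ ^ 2) else 0) := by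
      rw [Finset.mul_sum]
      have : ∀ σ : V → Fin 2, (1 / 2 : ℝ) * (if σ x ≠ σ y then ψ σ * ψ (σ ∘ Equiv.swap x y) *
            (‖u σ‖ ^ 2 + ‖u (σ ∘ Equiv.swap x y)‖ ^ 2) else 0)
          = (1 / 2 : ℝ) * (if σ x ≠ σ y then ψ σ * ψ (σ ∘ Equiv.swap x y) * ‖u σ‖ ^ 2 else 0)
            + (1 / 2 : ℝ) * (if σ x ≠ σ y then
              ψ σ * ψ (σ ∘ Equiv.swap x y) * ‖u (σ ∘ Equiv.swap x y)‖ ^ 2 else 0) := by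
        intro σ; split_ifs <;> ring
      simp_rw [this]
      rw [Finset.sum_add_distrib, ← Finset.mul_sum, ← Finset.mul_sum, ← hsym]
      ring
    rw [hhalf, Finset.mul_sum, Finset.mul_sum, ← Finset.sum_sub_distrib, Finset.mul_sum]
    refine Finset.sum_congr rfl fun σ _ => ?_
    split_ifs with hne
    · rw [hsq]; ring
    · simp

end Summit.HubbardSuperconductivity.HubbardSuperconductivity.Theorems.AnisotropyChord.Stiffness
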